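import Mathlib
import HarnessLib
import Summits.ResolutionOfSingularities.ResolutionOfSingularities.Theorems.WildQuotientsWildQuotientResolutionS1aMultGood
import Summits.ResolutionOfSingularities.ResolutionOfSingularities.Theorems.WildQuotientsWildQuotientResolutionS1aKillFreeTransport

/-!
# S1a — (M) MULT-GOOD, node data: the LAURENT REFINEMENT of a chart of the K-free frame is PRINCIPAL NEAR EVERY POINT

[OURS · L1 W4.5c · lead-1 g11; A-KF v0 (O4) «refinement is necessary — add the Laurent chart at a multiplicative point», SIG (M) v2, ASSIGNMENT v10.34
«(M) refinement tool»] — NOT statements of the manuscript; counted 0; AI-level work, weaker than expert review. Crux stmt-ResolutionOfSingularities-17941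
`CyclicQuotientFourfolds`, line `s1a-logminvertex` v12 (`stub_reachLowerInF`): PRODUCER TOOL for the REFINEMENT nodes of `TreeF`.

Given node data `D` on a stable affine chart `O` (`NpFrame.NodeData`) and a degree-`0` unit `u` of its node ring with `∏_{i<p} σ^i u = 1` (the cocycle of a
unit-row semi-invariant, `MultGood.prod_range_iterate_eq_one_of_semiInvariant`), the LAURENT NODE DATA `D.laurent u` on the SAME chart `O`: node ring
`B[T;T⁻¹]`, grading `laurentPiece` re-indexed to `Π j : Fin (m+1), ZMod (Fin.cons 0 r j)` (`NodeReindex`), `σ″ = sigmaLaurent σ u`, coordinate map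
`e″ = C ∘ e` (`gradeZeroLaurentEquiv`). If `augmentationIdeal σ ≤ (β)` and `u - 1 = β ρ` with `ρ` a unit, then `D.laurent u` is `PrincipalNear` EVERY point of
`O` (witness: the unit section) — in the K-free frame, adjoining `D.laurent u` to the atlas deletes `O` from the carried formal locus `F_𝔄` (a REFINEMENT node).

* `MultGood.coeff_C_zero'`, `MultGood.gradeZeroLaurentEquiv` (`C : 𝒜 0 ≃+* laurentPiece 𝒜 0`), `coe_gradeZeroLaurentEquiv`, `isPrincipal_map_of_eq_span`;
* ★★ `NpFrame.NodeData.laurent`, `laurent_B`, ★★ `NpFrame.NodeData.principalNear_laurent`.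
-/

set_option linter.dupNamespace false

noncomputable section

open CategoryTheory AlgebraicGeometry DirectSum Literature.AlgebraicGeometry.Resolution Literature.AlgebraicGeometry.RelativeSpec
open scoped LaurentPolynomial
open Summit.ResolutionOfSingularities.ResolutionOfSingularities.Theorems.WildQuotientResolution.S1
open Summit.ResolutionOfSingularities.ResolutionOfSingularities.Theorems.WildQuotientResolution.S1.ReesBigrading
open Summit.ResolutionOfSingularities.ResolutionOfSingularities.Theorems.WildQuotientResolution.S1.ProducerStep
open Summit.ResolutionOfSingularities.ResolutionOfSingularities.Theorems.WildQuotientResolution.S1.NodeAtlas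
open Summit.ResolutionOfSingularities.ResolutionOfSingularities.Theorems.WildQuotientResolution.S1.GoodCharts

universe u v

namespace Summit.ResolutionOfSingularities.ResolutionOfSingularities.Theorems.WildQuotientResolution.S1.MultGood

section GradeZero

variable {ι : Type v} [AddCommGroup ι] [DecidableEq ι] {B : Type u} [CommRing B] (𝒜 : ι → AddSubgroup B) [GradedRing 𝒜]

omit [AddCommGroup ι] [DecidableEq ι] [GradedRing 𝒜] in
/-- `(C x).coeff 0 = x`. -/
theorem coeff_C_zero' (x : B) : (LaurentPolynomial.C x : B[T;T⁻¹]).coeff 0 = x := by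
  rw [← mul_one (LaurentPolynomial.C x), ← LaurentPolynomial.T_zero, coeff_C_mul_T, if_pos rfl]

/-- **`C : 𝒜 0 ≃+* laurentPiece 𝒜 0`** — the degree-`0` part of the Laurent node is the degree-`0` part of the node. [OURS · L1 W4.5c · (M)] -/
def gradeZeroLaurentEquiv : letI := laurentGradedRing 𝒜; ↥(𝒜 0) ≃+* ↥(laurentPiece 𝒜 0) :=
  letI := laurentGradedRing 𝒜
  { toFun := fun x => ⟨LaurentPolynomial.C (x : B), C_mem_laurentPiece 𝒜 x.2⟩
    invFun := fun q => ⟨(q : B[T;T⁻¹]).coeff 0, (coeff_of_mem_laurentPiece 𝒜 q.2 0).1⟩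
    left_inv := fun x => Subtype.ext (coeff_C_zero' (x : B))
    right_inv := fun q => Subtype.ext (by
      obtain ⟨x, hx, hq⟩ := q.2
      change LaurentPolynomial.C ((q : B[T;T⁻¹]).coeff 0) = (q : B[T;T⁻¹])
      rw [hq, Prod.fst_zero, LaurentPolynomial.T_zero, mul_one, coeff_C_zero'])
    map_mul' := fun x y => Subtype.ext (map_mul LaurentPolynomial.C (x : B) (y : B))
    map_add' := fun x y => Subtype.ext (map_add LaurentPolynomial.C (x : B) (y : B)) }

/-- Pin: the underlying Laurent polynomial of `gradeZeroLaurentEquiv x` is `C x`. -/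
theorem coe_gradeZeroLaurentEquiv (x : ↥(𝒜 0)) :
    letI := laurentGradedRing 𝒜; ((gradeZeroLaurentEquiv 𝒜 x : ↥(laurentPiece 𝒜 0)) : B[T;T⁻¹]) = LaurentPolynomial.C (x : B) := rfl

end GradeZero

/-- The extension of a principal ideal along a ring map is principal. -/
theorem isPrincipal_map_of_eq_span {R S : Type*} [CommRing R] [CommRing S] (f : R →+* S) {I : Ideal R} {x : R} (h : I = Ideal.span {x}) :
    (I.map f).IsPrincipal := by
  rw [h, Ideal.map_span, Set.image_singleton]
  exact ⟨⟨_, by rw [Ideal.submodule_span_eq]⟩⟩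

end Summit.ResolutionOfSingularities.ResolutionOfSingularities.Theorems.WildQuotientResolution.S1.MultGood

namespace Summit.ResolutionOfSingularities.ResolutionOfSingularities.Theorems.WildQuotientResolution.S1.NpFrame.NodeData

open Summit.ResolutionOfSingularities.ResolutionOfSingularities.Theorems.WildQuotientResolution.S1.MultGood

variable {p : ℕ} {V Y : Scheme.{0}} {q : V ⟶ Y} {G : Type} [Group G] {ρ : ActionOver q G} {g₀ : G} {O : ρ.StableAffineOpens}
  (D : NodeData p ρ g₀ O)

/-- ★★ **LAURENT NODE DATA** on the same chart: node ring `B[T;T⁻¹]`, grading `laurentPiece` re-indexed by `consIndexEquiv` (`r″ = Fin.cons 0 r`),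
`σ″ = sigmaLaurent σ u`, `e″ = C ∘ e`; for a degree-`0` unit `u` with `∏_{i<p} σ^i u = 1`. [OURS · L1 W4.5c · (M) refinement tool] -/
def laurent (u : letI := D.instCommRing; (D.B)ˣ) (hu0 : letI := D.instCommRing; (u : D.B) ∈ D.𝒜 0)
    (hnorm : letI := D.instCommRing; ∏ i ∈ Finset.range p, (⇑D.σ)^[i] (u : D.B) = 1) : NodeData p ρ g₀ O :=
  letI := D.instCommRing; letI := D.instGradedRing
  letI hL : GradedRing (laurentPiece D.𝒜) := laurentGradedRing D.𝒜
  letI hR : GradedRing (reindex (laurentPiece D.𝒜) (consIndexEquiv D.r)) := reindexGradedRing _ _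
  { affine := D.affine
    m := D.m + 1
    r := Fin.cons 0 D.r
    B := LaurentPolynomial D.B
    instCommRing := inferInstance
    𝒜 := reindex (laurentPiece D.𝒜) (consIndexEquiv D.r)
    instGradedRing := hR
    σ := sigmaLaurent D.σ u
    e := (D.e.trans (gradeZeroLaurentEquiv D.𝒜)).trans
      (gradeZeroEquivOfEq (laurentPiece D.𝒜) (reindex (laurentPiece D.𝒜) (consIndexEquiv D.r)) (reindex_zero _ _))
    tame := isTameNode_reindex _ (consIndexEquiv D.r) p _ (isTameNode_laurent D.𝒜 D.σ D.tame u hu0 hnorm)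
    intertwine := fun t => by
      change LaurentPolynomial.C ((D.e (actO ρ O g₀ t) : ↥(D.𝒜 0)) : D.B) =
        sigmaLaurent D.σ u (LaurentPolynomial.C ((D.e t : ↥(D.𝒜 0)) : D.B))
      rw [D.intertwine t, sigmaLaurent_C] }

/-- The node ring of the Laurent node data. -/
theorem laurent_B (u : letI := D.instCommRing; (D.B)ˣ) (hu0 : letI := D.instCommRing; (u : D.B) ∈ D.𝒜 0)
    (hnorm : letI := D.instCommRing; ∏ i ∈ Finset.range p, (⇑D.σ)^[i] (u : D.B) = 1) :
    (D.laurent u hu0 hnorm).B = (letI := D.instCommRing; LaurentPolynomial D.B) := rfl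

/-- ★★ **THE LAURENT REFINEMENT IS PRINCIPAL NEAR EVERY POINT OF THE CHART** — if `augmentationIdeal σ ≤ (β)` and `u - 1 = β ρ′` with `ρ′` a unit
(the multiplicative-type row is a unit ON `O`; shrink `O` first by `NodeData.restrict`), then `(D.laurent u).PrincipalNear x` for every `x ∈ O`
(witness: the unit section; `augmentationIdeal σ″ = (C β)`). [OURS · L1 W4.5c · (M) refinement tool] -/
theorem principalNear_laurent (u : letI := D.instCommRing; (D.B)ˣ) (hu0 : letI := D.instCommRing; (u : D.B) ∈ D.𝒜 0)
    (hnorm : letI := D.instCommRing; ∏ i ∈ Finset.range p, (⇑D.σ)^[i] (u : D.B) = 1)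
    (β ρ' : D.B) (haug : letI := D.instCommRing; augmentationIdeal D.σ ≤ Ideal.span {β})
    (hu : letI := D.instCommRing; (u : D.B) - 1 = β * ρ') (hρ : letI := D.instCommRing; IsUnit ρ') {x : V} (hx : x ∈ O.1) :
    (D.laurent u hu0 hnorm).PrincipalNear x := by
  letI := D.instCommRing; letI := D.instGradedRing; letI := (D.laurent u hu0 hnorm).instCommRing
  refine ⟨1, fun g => map_one _, ?_, ?_⟩
  · rw [Scheme.basicOpen_of_isUnit _ isUnit_one]; exact hx
  · exact isPrincipal_map_of_eq_span _ (augmentationIdeal_sigmaLaurent_eq_span D.σ u β ρ' haug hu hρ)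

end Summit.ResolutionOfSingularities.ResolutionOfSingularities.Theorems.WildQuotientResolution.S1.NpFrame.NodeData

end
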